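import Literature.Computability.Cryptography.PerfectRandomizedEncoding
import HarnessLib

/-!
# The locality reduction: a sum of `k` terms has a perfect randomized encoding each of whose
# outputs reads ONE term (Applebaum–Ishai–Kushilevitz, Construction 4.16) — and its use for range
# avoidance (Gajulapalli–Golovnev–Nagargoje–Saraogi 2023, Lemma 1)

**Construction** [Applebaum–Ishai–Kushilevitz 2006, §4.3, Construction 4.16 / Lemma 4.17;
Gajulapalli–Golovnev–Nagargoje–Saraogi 2023, Lemma 1 (= §2.3 of arXiv:2303.05044, "there is a
polynomial time reduction from degree-`d`-Avoid to `NC⁰_{d+1}`-Avoid … for completeness, we include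
the proof here")].  For a single output `g(x) = T₁(x) + ⋯ + T_k(x)` over `F₂` (in print the `Tᵢ`
are the monomials of a degree-`d` polynomial; the construction uses nothing about them), the map

  `ĝ(x; r, s) = (T₁(x) + r₁, …, T_k(x) + r_k ;  r₁ + s₁, s₁ + r₂ + s₂, …, s_{k−2} + r_{k−1} + s_{k−1}, s_{k−1} + r_k)`

with fresh `r ∈ F₂^k`, `s ∈ F₂^{k−1}` (signs are immaterial over `F₂`) is a PERFECT RANDOMIZED
ENCODING of `g` with blowup `2^{2k−1}` (`sumEnc_isPerfectRandomizedEncoding`): the `2k` output bits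
sum to `g(x)` (`sumDec_sumEnc`, the decoder), the randomness is recovered from the output
(`sumEnc_injective`), and EVERY `y` whose bits sum to `g(x)` is `ĝ(x; r, s)` for some `(r, s)`
(`sumEnc_solve`, the statement GGNS use: "for all `x, y`, if `Dec(y) = f(x)`, there exists an `r`
such that `f̂(x, r) = y`").  Output `i` of the first half reads only `Tᵢ` and `rᵢ`; output `i` of
the second half reads only `rᵢ, s_{i−1}, sᵢ` (`sumEnc_inl_dependsOnly`, `sumEnc_inr_dependsOnly`):
so if every `Tᵢ` is a monomial of degree `≤ d`, every output has locality `≤ max(d + 1, 3)` (AIK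
Lemma 4.17), i.e. `≤ d + 1` for `d ≥ 2` (GGNS Lemma 1).

**Multi-output form and range avoidance** [GGNS 2023, Lemma 1 and the proof of their Theorem 2]:
for `f : F₂ⁿ → F₂^m` with every output a sum of `k` monomials of degree `≤ d`
(`MonoSumMap d k n m`), the encoding `MonoSumMap.encode` has `n + (2k−1)m` inputs and `2km` outputs
(`card_aikIn`, `card_aikOut`), every output depends on at most `max (d+1) 3` inputs
(`encode_dependsOnly`; `≤ d + 1` for `2 ≤ d`, `encode_dependsOnly_succ`), it is a perfect randomized
encoding of `f` with blowup `2^{(2k−1)m}` (`isPerfectRandomizedEncoding_encodeCurried`, `card_rand`),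
`Dec ∘ f̂ = f` (`decode_encode`), every `y` with `Dec(y) = f(x)` is some `f̂(x, r)` (`encode_solve`,
`mem_range_encode_iff`), and a point OUTSIDE the range of `f̂` decodes to a point outside the range
of `f` (`decode_not_mem_range`) — the reduction of degree-`d`-Avoid to `NC⁰_{d+1}`-Avoid.  The
printed stretch bookkeeping is recorded as `aik_surplus`
(`#outputs − #inputs = m − n`: the additive surplus is preserved, so the encoded stretch
`2km / (n + (2k−1)m)` is always below `2k/(2k−1) ≤ 2`).

NOT here: polynomial-time computability of the (explicit, primitive recursive) maps `f ↦ f̂` and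
`Dec` as `IsPolyTime` string functions, and the packaging of `MonoSumMap.encode` as a syntactic
`Literature.Computability.Complexity.LocalMap (d+1)` (RangeAvoidance.lean) — both routine, left to
the consumer that fixes string conventions; the degree-3 encoding of branching programs is
`BranchingProgramEncoding.lean`.

## References

* B. Applebaum, Y. Ishai, E. Kushilevitz, *Cryptography in NC⁰*, SIAM J. Comput. 36(4) (2006)
  845–888, §4.3 (Construction 4.16, Lemma 4.17: reducing locality).  bib `ApplebaumIshaiKushilevitz2006`.
* K. Gajulapalli, A. Golovnev, S. Nagargoje, S. Saraogi, *Range Avoidance for Constant-Depth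
  Circuits: Hardness and Algorithms*, APPROX/RANDOM 2023, LIPIcs 275, 65; arXiv:2303.05044, §2.3
  Lemma 1 (lem:degree-encoding) and its Corollary.  bib `GajulapalliEtAl2023`.
-/

namespace Literature.Computability.Cryptography

open Finset

/-! ### Arithmetic in `F₂` -/

/-- `a + a = 0` in `F₂`. [folklore] -/
private theorem zmod2_add_self (a : ZMod 2) : a + a = 0 := by decide +revert

/-- `a + (b + a) = b` in `F₂`. [folklore] -/
private theorem zmod2_add_add_cancel (a b : ZMod 2) : a + (b + a) = b := by decide +revert

/-- `a = b → a + b = 0` in `F₂`. [folklore] -/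
private theorem zmod2_add_eq_zero_of_eq {a b : ZMod 2} (h : a = b) : a + b = 0 := by
  subst h; exact zmod2_add_self a

/-- `u + (v + w) = 0 → u + w = v` in `F₂`. [folklore] -/
private theorem zmod2_solve {u v w : ZMod 2} (h : u + (v + w) = 0) : u + w = v := by
  revert u v w h; decide

/-! ### The single-output construction [AIK 2006, Construction 4.16] -/

section SumEncoding

variable {α : Type*} {k : ℕ}

/-- Randomness of the encoding of one output: `r ∈ F₂^k` and `s ∈ F₂^{k-1}`.
[cite: ApplebaumIshaiKushilevitz2006, Construction 4.16] -/
abbrev SumRand (k : ℕ) := (Fin k → ZMod 2) × (Fin (k - 1) → ZMod 2)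

/-- The chain variables `s` extended by `0` to all natural indices (so that `s₀ := 0 =: s_k` in the
1-based indexing of print). [folklore] -/
def sExt (s : Fin (k - 1) → ZMod 2) (t : ℕ) : ZMod 2 :=
  if h : t < k - 1 then s ⟨t, h⟩ else 0

/-- **AIK Construction 4.16** for `g = ∑ᵢ Tᵢ`: output `inl i` is `Tᵢ(x) + rᵢ`, output `inr i` is
`s_{i-1} + rᵢ + sᵢ` (0-based, with the out-of-range `s`'s read as `0`).
[cite: ApplebaumIshaiKushilevitz2006, Construction 4.16] [cite: GajulapalliEtAl2023, Lemma 1 (proof)] -/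
def sumEnc (T : Fin k → α → ZMod 2) (x : α) (ρ : SumRand k) : Fin k ⊕ Fin k → ZMod 2
  | Sum.inl i => T i x + ρ.1 i
  | Sum.inr i => (if (i : ℕ) = 0 then 0 else sExt ρ.2 (i - 1)) + ρ.1 i + sExt ρ.2 i

/-- The decoder: the sum of all `2k` output bits. [cite: GajulapalliEtAl2023, Lemma 1 (proof: `Dec`)] -/
def sumDec (y : Fin k ⊕ Fin k → ZMod 2) : ZMod 2 := ∑ o, y o

/-- The two chain sums agree: `∑ᵢ s_{i-1} = ∑ᵢ sᵢ` (both are `∑_{t<k-1} s_t`) — the telescoping step of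
the decoder "summing up the bits of `ŷ`". [cite: ApplebaumIshaiKushilevitz2006, Lemma 4.17 (proof)] -/
theorem sum_chain_eq (s : Fin (k - 1) → ZMod 2) :
    (∑ i : Fin k, (if (i : ℕ) = 0 then (0 : ZMod 2) else sExt s (i - 1))) = ∑ i : Fin k, sExt s i := by
  cases k with
  | zero => simp
  | succ k' =>
    rw [Fin.sum_univ_succ, Fin.sum_univ_castSucc]
    have hlast : sExt s ((Fin.last k' : Fin (k' + 1)) : ℕ) = 0 := by
      simp [sExt]
    rw [hlast, add_zero]
    simp only [Fin.val_zero, ↓reduceIte, zero_add, Fin.val_succ, Nat.succ_ne_zero,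
      Nat.add_sub_cancel, Fin.val_castSucc]

/-- **Decoding**: the output bits of `ĝ(x; r, s)` sum to `g(x) = ∑ᵢ Tᵢ(x)`.
[cite: ApplebaumIshaiKushilevitz2006, Lemma 4.17] [cite: GajulapalliEtAl2023, Lemma 1] -/
theorem sumDec_sumEnc (T : Fin k → α → ZMod 2) (x : α) (ρ : SumRand k) :
    sumDec (sumEnc T x ρ) = ∑ i, T i x := by
  unfold sumDec
  rw [Fintype.sum_sum_type]
  simp only [sumEnc]
  rw [sum_add_distrib, sum_add_distrib, sum_add_distrib, sum_chain_eq]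
  -- ∑T + ∑r + (∑s + ∑r + ∑s) = ∑T
  set A := ∑ i : Fin k, T i x
  set R := ∑ i : Fin k, ρ.1 i
  set S := ∑ i : Fin k, sExt ρ.2 (i : ℕ)
  calc A + R + (S + R + S) = A + ((R + R) + (S + S)) := by ring
    _ = A := by rw [zmod2_add_self, zmod2_add_self, add_zero, add_zero]

/-- **Output disjointness**: equal encodings have equal decoded values. [cite: ApplebaumIshaiKushilevitz2006, Lemma 4.17] -/
theorem sumEnc_dec_eq (T : Fin k → α → ZMod 2) {x x' : α} {ρ ρ' : SumRand k}
    (h : sumEnc T x ρ = sumEnc T x' ρ') : (∑ i, T i x) = ∑ i, T i x' := by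
  rw [← sumDec_sumEnc T x ρ, ← sumDec_sumEnc T x' ρ', h]

/-- **Unique randomness**: `ĝ(x; ·)` is injective. [cite: ApplebaumIshaiKushilevitz2006, Lemma 4.17] -/
theorem sumEnc_injective (T : Fin k → α → ZMod 2) (x : α) : Function.Injective (sumEnc T x) := by
  rintro ⟨r, s⟩ ⟨r', s'⟩ h
  have hr : r = r' := by
    funext i
    have := congrFun h (Sum.inl i)
    simpa [sumEnc] using this
  subst hr
  have hs : ∀ t : ℕ, ∀ ht : t < k - 1, s ⟨t, ht⟩ = s' ⟨t, ht⟩ := by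
    intro t
    induction t with
    | zero =>
      intro ht
      have hk : 0 < k := by omega
      have := congrFun h (Sum.inr ⟨0, hk⟩)
      simpa [sumEnc, sExt, ht] using this
    | succ t ih =>
      intro ht
      have hk : t + 1 < k := by omega
      have ht' : t < k - 1 := by omega
      have := congrFun h (Sum.inr ⟨t + 1, hk⟩)
      simp only [sumEnc, Nat.succ_ne_zero, ↓reduceIte, Nat.add_sub_cancel, sExt, ht', ht,
        dif_pos, ih ht'] at this
      simpa using this
  congr 1
  funext ⟨t, ht⟩
  exact hs t ht

/-- The `r`-part of the randomness solving `ĝ(x; r, s) = y`: `rᵢ = y_{inl i} + Tᵢ(x)`.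
[cite: GajulapalliEtAl2023, Lemma 1 (proof)] -/
def solveR (T : Fin k → α → ZMod 2) (x : α) (y : Fin k ⊕ Fin k → ZMod 2) : Fin k → ZMod 2 :=
  fun i => y (Sum.inl i) + T i x

/-- The summands `y_{inr u} + r_u` of the chain, as a function of a natural index (zero beyond `k`)
(bookkeeping for the "unique way" to complete the randomness in the proof of the locality lemma).
[cite: ApplebaumIshaiKushilevitz2006, Lemma 4.17 (proof)] [cite: GajulapalliEtAl2023, Lemma 1 (proof)] -/
def chainTerm (T : Fin k → α → ZMod 2) (x : α) (y : Fin k ⊕ Fin k → ZMod 2) (u : ℕ) : ZMod 2 :=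
  if h : u < k then y (Sum.inr ⟨u, h⟩) + (y (Sum.inl ⟨u, h⟩) + T ⟨u, h⟩ x) else 0

/-- The `s`-part of the randomness solving `ĝ(x; r, s) = y`: `s_t = ∑_{u ≤ t} (y_{inr u} + r_u)`
(the telescoped form of `s₁ = y'₁ + r₁`, `s_t = y'_t + r_t + s_{t-1}`).
[cite: GajulapalliEtAl2023, Lemma 1 (proof)] -/
def solveS (T : Fin k → α → ZMod 2) (x : α) (y : Fin k ⊕ Fin k → ZMod 2) : Fin (k - 1) → ZMod 2 :=
  fun t => ∑ u ∈ range ((t : ℕ) + 1), chainTerm T x y u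

/-- The full chain sum is `Dec(y) + g(x)` (so it vanishes exactly when `Dec(y) = g(x)`).
[cite: ApplebaumIshaiKushilevitz2006, Lemma 4.17 (proof)] [cite: GajulapalliEtAl2023, Lemma 1 (proof)] -/
theorem sum_chainTerm_range (T : Fin k → α → ZMod 2) (x : α) (y : Fin k ⊕ Fin k → ZMod 2) :
    (∑ u ∈ range k, chainTerm T x y u) = sumDec y + ∑ i, T i x := by
  rw [← Fin.sum_univ_eq_sum_range (fun u => chainTerm T x y u) k]
  have : ∀ i : Fin k, chainTerm T x y (i : ℕ) = y (Sum.inr i) + (y (Sum.inl i) + T i x) := by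
    intro i; simp [chainTerm, i.2]
  simp only [this, sum_add_distrib]
  unfold sumDec
  rw [Fintype.sum_sum_type]
  ring

/-- **Range covering (GGNS Lemma 1)**: every `y` with `Dec(y) = g(x)` is an encoding of `x`, with
the explicit randomness `(solveR, solveS)`. [cite: GajulapalliEtAl2023, Lemma 1]
[cite: ApplebaumIshaiKushilevitz2006, Lemma 4.17] -/
theorem sumEnc_solve (T : Fin k → α → ZMod 2) (x : α) (y : Fin k ⊕ Fin k → ZMod 2)
    (h : sumDec y = ∑ i, T i x) : sumEnc T x (solveR T x y, solveS T x y) = y := by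
  have htot : (∑ u ∈ range k, chainTerm T x y u) = 0 := by
    rw [sum_chainTerm_range, h, zmod2_add_self]
  funext o
  cases o with
  | inl i =>
    simp only [sumEnc, solveR]
    rw [add_comm (y (Sum.inl i)) (T i x), ← add_assoc, zmod2_add_self, zero_add]
  | inr i =>
    have hik : (i : ℕ) < k := i.2
    -- the first chain summand is `∑_{u < i} chainTerm u`
    have hP : (if (i : ℕ) = 0 then (0 : ZMod 2) else sExt (solveS T x y) ((i : ℕ) - 1)) =
        ∑ u ∈ range (i : ℕ), chainTerm T x y u := by
      by_cases hi : (i : ℕ) = 0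
      · rw [if_pos hi, hi, sum_range_zero]
      · rw [if_neg hi]
        have hlt : (i : ℕ) - 1 < k - 1 := by omega
        simp only [sExt, hlt, dif_pos, solveS]
        congr 1
        congr 1
        omega
    have hr : solveR T x y i = y (Sum.inl i) + T i x := rfl
    have hc : chainTerm T x y (i : ℕ) = y (Sum.inr i) + (y (Sum.inl i) + T i x) := by
      simp [chainTerm, hik]
    simp only [sumEnc]
    rw [hP, hr]
    by_cases hlast : (i : ℕ) < k - 1
    · -- interior output: s_i is defined
      have hQ : sExt (solveS T x y) (i : ℕ) = ∑ u ∈ range ((i : ℕ) + 1), chainTerm T x y u := by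
        simp only [sExt, hlast, dif_pos, solveS]
      rw [hQ, sum_range_succ, hc]
      set P := ∑ u ∈ range (i : ℕ), chainTerm T x y u
      set a := y (Sum.inl i) + T i x
      calc P + a + (P + (y (Sum.inr i) + a)) = y (Sum.inr i) + ((P + P) + (a + a)) := by ring
        _ = y (Sum.inr i) := by rw [zmod2_add_self, zmod2_add_self, add_zero, add_zero]
    · -- last output: s_i is out of range (= 0) and the hypothesis closes the chain
      have hQ : sExt (solveS T x y) (i : ℕ) = 0 := by simp [sExt, hlast]
      have hi1 : (i : ℕ) + 1 = k := by omega
      rw [hQ, add_zero]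
      have : (∑ u ∈ range (i : ℕ), chainTerm T x y u) + (y (Sum.inr i) + (y (Sum.inl i) + T i x)) = 0 := by
        rw [← hc, ← sum_range_succ, hi1, htot]
      set P := ∑ u ∈ range (i : ℕ), chainTerm T x y u
      set a := y (Sum.inl i) + T i x
      -- from P + (y + a) = 0 deduce P + a = y
      exact zmod2_solve this

/-- **The locality reduction is a perfect randomized encoding** with blowup `2^{2k-1}` (all of the
randomness: AIK's stretch-preserving case). [cite: ApplebaumIshaiKushilevitz2006, Lemma 4.17]
[cite: GajulapalliEtAl2023, Lemma 1] -/
theorem sumEnc_isPerfectRandomizedEncoding (T : Fin k → α → ZMod 2) :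
    IsPerfectRandomizedEncoding (fun x => ∑ i, T i x) (sumEnc T) (Fintype.card (SumRand k)) :=
  IsPerfectRandomizedEncoding.of_injective (sumEnc_injective T)
    (fun _ _ _ _ h => sumEnc_dec_eq T h)
    (fun x x' hxx' ρ => ⟨(solveR T x' (sumEnc T x ρ), solveS T x' (sumEnc T x ρ)),
      sumEnc_solve T x' _ (by rw [sumDec_sumEnc, hxx'])⟩)

/-- The blowup in closed form: `|F₂^k × F₂^{k-1}| = 2^{2k-1}` for `k ≥ 1` ("since `m = 2k − 1` and
`s = 2k`, the encoding `f̂` is stretch preserving"). [cite: ApplebaumIshaiKushilevitz2006, Lemma 4.17 (proof)] -/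
theorem card_sumRand (hk : 1 ≤ k) : Fintype.card (SumRand k) = 2 ^ (2 * k - 1) := by
  simp only [SumRand, Fintype.card_prod, Fintype.card_fun, ZMod.card, Fintype.card_fin]
  rw [← pow_add]
  congr 1
  omega

/-- **Locality of the first half**: output `inl i` depends on `x` only through `Tᵢ(x)` and on the
randomness only through `rᵢ`. [cite: ApplebaumIshaiKushilevitz2006, Construction 4.16] -/
theorem sumEnc_inl_dependsOnly (T : Fin k → α → ZMod 2) {x x' : α} {ρ ρ' : SumRand k} (i : Fin k)
    (hT : T i x = T i x') (hr : ρ.1 i = ρ'.1 i) : sumEnc T x ρ (Sum.inl i) = sumEnc T x' ρ' (Sum.inl i) := by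
  simp [sumEnc, hT, hr]

/-- **Locality of the second half**: output `inr i` does not depend on `x` and depends on the
randomness only through `rᵢ`, `s_{i-1}`, `sᵢ` (three bits). [cite: ApplebaumIshaiKushilevitz2006, Construction 4.16] -/
theorem sumEnc_inr_dependsOnly (T : Fin k → α → ZMod 2) {x x' : α} {ρ ρ' : SumRand k} (i : Fin k)
    (hr : ρ.1 i = ρ'.1 i) (hs : ∀ t : Fin (k - 1), ((t : ℕ) = i ∨ (t : ℕ) + 1 = i) → ρ.2 t = ρ'.2 t) :
    sumEnc T x ρ (Sum.inr i) = sumEnc T x' ρ' (Sum.inr i) := by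
  have h1 : sExt ρ.2 (i : ℕ) = sExt ρ'.2 (i : ℕ) := by
    by_cases h : (i : ℕ) < k - 1
    · simp only [sExt, h, dif_pos]; exact hs ⟨i, h⟩ (Or.inl rfl)
    · simp [sExt, h]
  have h2 : (if (i : ℕ) = 0 then (0 : ZMod 2) else sExt ρ.2 ((i : ℕ) - 1)) =
      (if (i : ℕ) = 0 then (0 : ZMod 2) else sExt ρ'.2 ((i : ℕ) - 1)) := by
    by_cases hi : (i : ℕ) = 0
    · simp [hi]
    · rw [if_neg hi, if_neg hi]
      by_cases h : (i : ℕ) - 1 < k - 1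
      · simp only [sExt, h, dif_pos]; exact hs ⟨(i : ℕ) - 1, h⟩ (Or.inr (by simp; omega))
      · simp [sExt, h]
  simp only [sumEnc, h1, h2, hr]

end SumEncoding

/-! ### Sums of `k` monomials of degree `≤ d` and the multi-output encoding [GGNS 2023, Lemma 1] -/

section MonoSum

variable {d k n m : ℕ}

/-- The monomial `∏_{i ∈ S} xᵢ` over `F₂` (`S = ∅` is the constant `1`). [folklore] -/
def monoEval (S : Finset (Fin n)) (x : Fin n → ZMod 2) : ZMod 2 := ∏ i ∈ S, x i

/-- A monomial only reads its own variables ("a sum of monomials, each having locality `d`").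
[cite: ApplebaumIshaiKushilevitz2006, §4.3 (Reducing the locality)] -/
theorem monoEval_congr (S : Finset (Fin n)) {x x' : Fin n → ZMod 2} (h : ∀ i ∈ S, x i = x' i) :
    monoEval S x = monoEval S x' :=
  Finset.prod_congr rfl h

/-- A multi-output map `F₂ⁿ → F₂^m` presented, output by output, as a sum of `k` terms, each a
monomial of degree `≤ d` (or the zero term `none`, to pad shorter sums): the input format of
GGNS's Lemma 1 ("every output computes a sum of `k` monomials of degree `≤ d`"); a map whose outputs
are degree-`≤ d` polynomials is of this form with `k = O(n^d)`.
[cite: GajulapalliEtAl2023, Lemma 1 and Def. 5 (degree-`d`-Avoid)] -/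
structure MonoSumMap (d k n m : ℕ) where
  /-- the `i`-th term of output `j`: `some S` is the monomial `∏_{i∈S} xᵢ`, `none` is `0` -/
  term : Fin m → Fin k → Option (Finset (Fin n))
  /-- every monomial has degree `≤ d` -/
  card_le : ∀ j i S, term j i = some S → S.card ≤ d

namespace MonoSumMap

/-- Value of a term. [folklore] -/
def termEval (t : Option (Finset (Fin n))) (x : Fin n → ZMod 2) : ZMod 2 :=
  match t with
  | none => 0
  | some S => monoEval S x

/-- The summands `T_{j,1}, …, T_{j,k}` of output `j`. [cite: GajulapalliEtAl2023, Lemma 1] -/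
def T (F : MonoSumMap d k n m) (j : Fin m) : Fin k → (Fin n → ZMod 2) → ZMod 2 :=
  fun i x => termEval (F.term j i) x

/-- The map `f : F₂ⁿ → F₂^m` itself: `f_j(x) = ∑ᵢ T_{j,i}(x)`. [cite: GajulapalliEtAl2023, Lemma 1] -/
def eval (F : MonoSumMap d k n m) (x : Fin n → ZMod 2) : Fin m → ZMod 2 :=
  fun j => ∑ i, F.T j i x

/-- Input positions of the encoding `f̂`: the `n` original variables, then the `k·m` variables `r`,
then the `(k−1)·m` variables `s`. [cite: GajulapalliEtAl2023, Lemma 1 (`f̂ : {0,1}^{n+(2k−1)m} → …`)] -/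
abbrev AIKIn (k n m : ℕ) := Fin n ⊕ ((Fin m × Fin k) ⊕ (Fin m × Fin (k - 1)))

/-- Output positions of `f̂`: `2k` per original output. [cite: GajulapalliEtAl2023, Lemma 1 (`… → {0,1}^{2km}`)] -/
abbrev AIKOut (k m : ℕ) := Fin m × (Fin k ⊕ Fin k)

/-- The original variables of an input vector of `f̂`. [folklore] -/
def xPart (w : AIKIn k n m → ZMod 2) : Fin n → ZMod 2 := fun i => w (Sum.inl i)

/-- The randomness `(r_{j,·}, s_{j,·})` of output `j` read off an input vector of `f̂`. [folklore] -/
def randPart (w : AIKIn k n m → ZMod 2) (j : Fin m) : SumRand k :=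
  (fun i => w (Sum.inr (Sum.inl (j, i))), fun t => w (Sum.inr (Sum.inr (j, t))))

/-- Assembling an input vector of `f̂` from `x` and per-output randomness. [folklore] -/
def mkIn (x : Fin n → ZMod 2) (ρ : Fin m → SumRand k) : AIKIn k n m → ZMod 2
  | Sum.inl i => x i
  | Sum.inr (Sum.inl (j, i)) => (ρ j).1 i
  | Sum.inr (Sum.inr (j, t)) => (ρ j).2 t

/-- Reading back the original variables. [cite: ApplebaumIshaiKushilevitz2006, Construction 4.16] -/
@[simp] theorem xPart_mkIn (x : Fin n → ZMod 2) (ρ : Fin m → SumRand k) : xPart (mkIn x ρ) = x := rfl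

/-- Reading back the randomness of output `j`. [cite: ApplebaumIshaiKushilevitz2006, Construction 4.16] -/
@[simp] theorem randPart_mkIn (x : Fin n → ZMod 2) (ρ : Fin m → SumRand k) (j : Fin m) :
    randPart (mkIn x ρ) j = ρ j := rfl

/-- **The encoding `f̂`** (GGNS Lemma 1 / AIK Construction 4.16 applied to every output with its own
randomness), as ONE map on input vectors. [cite: GajulapalliEtAl2023, Lemma 1]
[cite: ApplebaumIshaiKushilevitz2006, Construction 4.16, Lemma 4.9] -/
def encode (F : MonoSumMap d k n m) (w : AIKIn k n m → ZMod 2) : AIKOut k m → ZMod 2 :=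
  fun o => sumEnc (F.T o.1) (xPart w) (randPart w o.1) o.2

/-- The same encoding curried as (input, randomness) ↦ output, the shape of
`IsPerfectRandomizedEncoding`. [cite: ApplebaumIshaiKushilevitz2006, Def. 4.6] -/
def encodeCurried (F : MonoSumMap d k n m) (x : Fin n → ZMod 2) (ρ : Fin m → SumRand k) :
    AIKOut k m → ZMod 2 :=
  fun o => sumEnc (F.T o.1) x (ρ o.1) o.2

/-- The one-map and the curried presentations of `f̂` agree. [cite: ApplebaumIshaiKushilevitz2006, Construction 4.16] -/
theorem encode_eq_encodeCurried (F : MonoSumMap d k n m) (w : AIKIn k n m → ZMod 2) :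
    F.encode w = F.encodeCurried (xPart w) (randPart w) := rfl

/-- The curried and the one-map presentations of `f̂` agree. [cite: ApplebaumIshaiKushilevitz2006, Construction 4.16] -/
theorem encodeCurried_eq_encode (F : MonoSumMap d k n m) (x : Fin n → ZMod 2) (ρ : Fin m → SumRand k) :
    F.encodeCurried x ρ = F.encode (mkIn x ρ) := rfl

/-- **The decoder `Dec`**: output `j` of `f` is the sum of the `2k` bits of block `j` of `f̂`.
[cite: GajulapalliEtAl2023, Lemma 1 (`Dec`)] -/
def decode (y : AIKOut k m → ZMod 2) : Fin m → ZMod 2 :=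
  fun j => sumDec (fun o => y (j, o))

/-- `Dec ∘ f̂ = f ∘ (original variables)`. [cite: GajulapalliEtAl2023, Lemma 1] -/
theorem decode_encode (F : MonoSumMap d k n m) (w : AIKIn k n m → ZMod 2) :
    decode (F.encode w) = F.eval (xPart w) := by
  funext j
  exact sumDec_sumEnc (F.T j) (xPart w) (randPart w j)

/-- **GGNS Lemma 1, the range property**: "for all `x, y`, if `Dec(y) = f(x)`, there exists an `r`
such that `f̂(x, r) = y`" — here with the randomness made explicit by `solveR`/`solveS`.
[cite: GajulapalliEtAl2023, Lemma 1] -/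
theorem encode_solve (F : MonoSumMap d k n m) (x : Fin n → ZMod 2) (y : AIKOut k m → ZMod 2)
    (h : decode y = F.eval x) :
    F.encode (mkIn x fun j => (solveR (F.T j) x (fun o => y (j, o)), solveS (F.T j) x (fun o => y (j, o)))) = y := by
  funext ⟨j, o⟩
  have hj : sumDec (fun o => y (j, o)) = ∑ i, F.T j i x := congrFun h j
  have := sumEnc_solve (F.T j) x (fun o => y (j, o)) hj
  exact congrFun this o

/-- Range form: `y ∈ Range(f̂) ↔ Dec(y) ∈ Range(f)`. [cite: GajulapalliEtAl2023, Lemma 1] -/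
theorem mem_range_encode_iff (F : MonoSumMap d k n m) (y : AIKOut k m → ZMod 2) :
    y ∈ Set.range F.encode ↔ decode y ∈ Set.range F.eval := by
  constructor
  · rintro ⟨w, rfl⟩
    exact ⟨xPart w, (decode_encode F w).symm⟩
  · rintro ⟨x, hx⟩
    exact ⟨_, encode_solve F x y hx.symm⟩

/-- **The reduction of degree-`d`-Avoid to `NC⁰_{d+1}`-Avoid**: a point outside the range of `f̂`
decodes to a point outside the range of `f`. [cite: GajulapalliEtAl2023, Lemma 1 and Cor. (proof:
"`Dec(y) ∉ Range(f)` and `Dec` runs in polynomial time")] -/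
theorem decode_not_mem_range (F : MonoSumMap d k n m) {y : AIKOut k m → ZMod 2}
    (hy : y ∉ Set.range F.encode) : decode y ∉ Set.range F.eval :=
  fun h => hy ((mem_range_encode_iff F y).2 h)

/-- **`f̂` is a perfect randomized encoding of `f`** with blowup `|F₂^k × F₂^{k−1}|^m = 2^{(2k−1)m}`
(concatenation of the single-output encodings with independent randomness).
[cite: ApplebaumIshaiKushilevitz2006, Lemma 4.17 with Lemma 4.9] -/
theorem isPerfectRandomizedEncoding_encodeCurried (F : MonoSumMap d k n m) :
    IsPerfectRandomizedEncoding F.eval F.encodeCurried (Fintype.card (Fin m → SumRand k)) := by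
  refine IsPerfectRandomizedEncoding.of_injective (fun x ρ ρ' h => ?_) (fun x x' ρ ρ' h => ?_)
    (fun x x' hxx' ρ => ?_)
  · funext j
    refine sumEnc_injective (F.T j) x (funext fun o => ?_)
    exact congrFun h (j, o)
  · funext j
    exact sumEnc_dec_eq (F.T j) (ρ := ρ j) (ρ' := ρ' j) (funext fun o => congrFun h (j, o))
  · refine ⟨fun j => (solveR (F.T j) x' (fun o => F.encodeCurried x ρ (j, o)),
      solveS (F.T j) x' (fun o => F.encodeCurried x ρ (j, o))), funext fun ⟨j, o⟩ => ?_⟩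
    have hj : sumDec (fun o => F.encodeCurried x ρ (j, o)) = ∑ i, F.T j i x' := by
      show sumDec (sumEnc (F.T j) x (ρ j)) = _
      rw [sumDec_sumEnc]
      exact congrFun hxx' j
    exact congrFun (sumEnc_solve (F.T j) x' _ hj) o

/-! #### Sizes and stretch [GGNS 2023, Lemma 1: `{0,1}^{n+(2k−1)m} → {0,1}^{2km}`] -/

/-- `f̂` has `n + (2k−1)·m` inputs (`k ≥ 1`). [cite: GajulapalliEtAl2023, Lemma 1] -/
theorem card_aikIn (hk : 1 ≤ k) : Fintype.card (AIKIn k n m) = n + (2 * k - 1) * m := by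
  obtain ⟨k', rfl⟩ : ∃ k', k = k' + 1 := ⟨k - 1, by omega⟩
  simp only [AIKIn, Fintype.card_sum, Fintype.card_prod, Fintype.card_fin, Nat.add_sub_cancel]
  have : 2 * (k' + 1) - 1 = 2 * k' + 1 := by omega
  rw [this]
  ring

/-- `f̂` has `2k·m` outputs. [cite: GajulapalliEtAl2023, Lemma 1] -/
theorem card_aikOut : Fintype.card (AIKOut k m) = 2 * k * m := by
  simp only [AIKOut, Fintype.card_prod, Fintype.card_sum, Fintype.card_fin]
  ring

/-- **The additive surplus is preserved**: `#outputs(f̂) + n = #inputs(f̂) + m`, i.e.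
`#outputs − #inputs = m − n` (so `f̂` is an Avoid instance iff `f` is, and the encoded stretch
`2km/(n + (2k−1)m)` never reaches `2k/(2k−1) ≤ 2`). [cite: GajulapalliEtAl2023, Lemma 1 and proof of Thm. 2
("This yields a stretch of `m̂(n̂) = n̂ + O(n̂^{2/(2+δ)})`")] -/
theorem aik_surplus (hk : 1 ≤ k) :
    Fintype.card (AIKOut k m) + n = Fintype.card (AIKIn k n m) + m := by
  rw [card_aikOut, card_aikIn hk]
  obtain ⟨k', rfl⟩ : ∃ k', k = k' + 1 := ⟨k - 1, by omega⟩
  have : 2 * (k' + 1) - 1 = 2 * k' + 1 := by omega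
  rw [this]
  ring

/-- The blowup in closed form: `2^{(2k−1)m}` (`k ≥ 1`). [cite: ApplebaumIshaiKushilevitz2006, Lemma 4.17] -/
theorem card_rand (hk : 1 ≤ k) : Fintype.card (Fin m → SumRand k) = 2 ^ ((2 * k - 1) * m) := by
  rw [Fintype.card_fun, Fintype.card_fin, card_sumRand hk, ← pow_mul]

/-! #### Locality `d + 1` [AIK 2006, Construction 4.16; GGNS 2023, Lemma 1: "each output bit of `ĝ` can be computed by an `NC⁰_{d+1}` circuit"] -/

/-- The input positions read by output `(j, inl i)`: the variables of the monomial `T_{j,i}` and `r_{j,i}`.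
[cite: ApplebaumIshaiKushilevitz2006, Construction 4.16] -/
def depsInl (F : MonoSumMap d k n m) (j : Fin m) (i : Fin k) : Finset (AIKIn k n m) :=
  ((F.term j i).getD ∅).map ⟨fun v => Sum.inl v, fun _ _ h => Sum.inl_injective h⟩ ∪
    {Sum.inr (Sum.inl (j, i))}

/-- The (at most three) input positions read by output `(j, inr i)`: `r_{j,i}`, `s_{j,i}`, `s_{j,i−1}`
(the `s`-positions falling outside `[0, k−1)` are replaced by `r_{j,i}` again). [cite: ApplebaumIshaiKushilevitz2006, Construction 4.16] -/
def depsInr (j : Fin m) (i : Fin k) : Finset (AIKIn k n m) :=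
  (Finset.univ : Finset (Fin 3)).image fun c : Fin 3 =>
    if (c : ℕ) = 1 then (if h : (i : ℕ) < k - 1 then Sum.inr (Sum.inr (j, ⟨i, h⟩)) else Sum.inr (Sum.inl (j, i)))
    else if (c : ℕ) = 2 then
      (if h : (i : ℕ) ≠ 0 ∧ (i : ℕ) - 1 < k - 1 then Sum.inr (Sum.inr (j, ⟨(i : ℕ) - 1, h.2⟩)) else Sum.inr (Sum.inl (j, i)))
    else Sum.inr (Sum.inl (j, i))

/-- A monomial output reads at most `d + 1` positions. [cite: ApplebaumIshaiKushilevitz2006, Lemma 4.17 (locality)] -/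
theorem card_depsInl_le (F : MonoSumMap d k n m) (j : Fin m) (i : Fin k) : (F.depsInl j i).card ≤ d + 1 := by
  unfold depsInl
  refine (Finset.card_union_le _ _).trans ?_
  rw [Finset.card_map, Finset.card_singleton]
  refine Nat.add_le_add_right ?_ 1
  cases hji : F.term j i with
  | none => simp
  | some S => simpa using F.card_le j i S hji

/-- A chain output reads at most `3` positions. [cite: ApplebaumIshaiKushilevitz2006, Lemma 4.17 (locality `max(d+1, 3)`)] -/
theorem card_depsInr_le (j : Fin m) (i : Fin k) : (depsInr (n := n) j i).card ≤ 3 :=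
  (Finset.card_image_le).trans (by simp)

/-- **Locality of `f̂`** (AIK Lemma 4.17: "locality `max(d + 1, 3)`"): every output depends on at
most `max (d + 1) 3` input positions — the monomial outputs read `≤ d + 1` positions, the chain
outputs read `3`. [cite: ApplebaumIshaiKushilevitz2006, Lemma 4.17] [cite: GajulapalliEtAl2023, Lemma 1] -/
theorem encode_dependsOnly (F : MonoSumMap d k n m) (o : AIKOut k m) :
    ∃ S : Finset (AIKIn k n m), S.card ≤ max (d + 1) 3 ∧
      ∀ w w' : AIKIn k n m → ZMod 2, (∀ a ∈ S, w a = w' a) → F.encode w o = F.encode w' o := by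
  obtain ⟨j, o⟩ := o
  cases o with
  | inl i =>
    refine ⟨F.depsInl j i, (F.card_depsInl_le j i).trans (le_max_left _ _), fun w w' hS => ?_⟩
    apply sumEnc_inl_dependsOnly
    · -- the monomial
      show termEval (F.term j i) (xPart w) = termEval (F.term j i) (xPart w')
      cases hji : F.term j i with
      | none => rfl
      | some U =>
        refine monoEval_congr U fun v hv => hS (Sum.inl v) ?_
        simp [depsInl, hji, hv]
    · exact hS _ (by simp [depsInl])
  | inr i =>
    refine ⟨depsInr j i, (card_depsInr_le j i).trans (le_max_right _ _), fun w w' hS => ?_⟩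
    apply sumEnc_inr_dependsOnly
    · exact hS _ (Finset.mem_image.2 ⟨⟨0, by omega⟩, Finset.mem_univ _, by simp⟩)
    · intro t ht
      show w (Sum.inr (Sum.inr (j, t))) = w' (Sum.inr (Sum.inr (j, t)))
      apply hS
      rcases ht with ht | ht
      · refine Finset.mem_image.2 ⟨⟨1, by omega⟩, Finset.mem_univ _, ?_⟩
        have h1 : (i : ℕ) < k - 1 := by have := t.2; omega
        have : (⟨(i : ℕ), h1⟩ : Fin (k - 1)) = t := Fin.ext ht.symm
        simp [h1, this]
      · refine Finset.mem_image.2 ⟨⟨2, by omega⟩, Finset.mem_univ _, ?_⟩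
        have h2 : (i : ℕ) ≠ 0 ∧ (i : ℕ) - 1 < k - 1 := ⟨by omega, by have := t.2; omega⟩
        have : (⟨(i : ℕ) - 1, h2.2⟩ : Fin (k - 1)) = t := Fin.ext (by simp; omega)
        simp [h2, this]

/-- **`NC⁰_{d+1}` form** (GGNS Lemma 1: "computed by an `NC⁰_{d+1}` circuit", `d ≥ 2`): every output
of `f̂` depends on at most `d + 1` input positions. [cite: GajulapalliEtAl2023, Lemma 1] -/
theorem encode_dependsOnly_succ (F : MonoSumMap d k n m) (hd : 2 ≤ d) (o : AIKOut k m) :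
    ∃ S : Finset (AIKIn k n m), S.card ≤ d + 1 ∧
      ∀ w w' : AIKIn k n m → ZMod 2, (∀ a ∈ S, w a = w' a) → F.encode w o = F.encode w' o := by
  obtain ⟨S, hS, h⟩ := F.encode_dependsOnly o
  exact ⟨S, hS.trans (max_le le_rfl (by omega)), h⟩

end MonoSumMap

end MonoSum

end Literature.Computability.Cryptography
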